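import Summits.QuantumFields.BalabanUV.Beta.CapRowsQhalf
import Summits.QuantumFields.BalabanUV.Beta.PolyRegularRestrict
import Summits.QuantumFields.BalabanUV.Beta.ConjReflectionAlgebra

/-!
# Beta / CapRowsQhalfOneLoop — BINDER-OWNERS row CAP-k, item (b): the PAIRED-ball (QHALF) anchor on the one-loop ∕ jet form with `hsym` DISCHARGED
# (β sub-cell, DEDICATED row BETA-an5, lineage `b2b-balaban-beta-an5` = OWNER of row CAP-k; gen 20, prover seat; sibling of `CapRowsQhalf`)

HONEST FRAMING (page 1 of everything the β sub-cell writes): discharging `BetaPertH` makes Bałaban's UV stability UNCONDITIONAL — a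
real constructive-QFT result; it is NOT the continuum limit and NOT the Clay problem.  HONEST DEPENDENCY (cell reorg 2026-08-19, verbatim):
«continuum YM on T⁴ ⇐ BetaPertH ∧ nine spine estimates (0/9 proved); BetaPertH ⇐ (D1) ∧ (D4) ∧ CAP+tail; G-an2-4 gates asym, D1 and NE2/3/4.»
THIS MODULE INSTANTIATES NO BINDER.  It composes, in ONE signature each, the three kernel pieces the cell landed on 2026-08-20 for a
PAIRED (q ∕ −q, «QHALF») certified total on the code16 node set (beta-cap-ref R61-b (iv) ∕ R62-c): this lineage's `CapRowsQhalf.rowsOfCode16E_ofRealBall`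
(real ball ⇒ the `hT` binder, under the structural `hsym`), cap3-g8's `PolyRegularRestrict.stripRegularC_oneLoopForm₂` ∕ `stripRegularC_jet_of_bound₂`
(the (Z) binder from STRUCTURE + (Z1) at the zero-free width `a` + a certificate at `κ ≤ a`), and beta-num-g12's `ConjReflectionAlgebra.oneLoopForm_hsym`
∕ `jet_hsym` (the `hsym` binder from REALITY of the stencil families: `MatConjSymm` ∕ `ConjSymm₃`).  RESULT: the anchor row and its certified-road END
for a paired total with EVERY binder named by kind and NO symmetry hypothesis left beyond the structural reality of the typed families:
(N) dictionary ∣ STRUCTURE `MatPolyHol` ×5 ∣ REALITY `MatConjSymm` ×5 (resp. `ConjSymm₃ f` + `PolyHol (jetFunctional f)`) ∣ (Z1) certificate ∣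
(Z2) certificate ∣ (T) a certified REAL ball for the full-node mean of real parts (what a paired engine sum delivers through
`CapRowsQhalf.sum_re_pairing`) ∣ (A) tail majorant (kernel: `CapLatticeBudget.budget_code16_param`) ∣ cmp; + rate ∕ `hk₂` ∕ (D4) for the END.
Nothing of Bałaban's is asserted; the cell's actual families live in the engines. [folklore]

ABSOLUTE RULE (cell charter, verbatim): "No internally-minted statement may enter as a cited fact. Every hypothesis is either
kernel-proved in this package or a verbatim quotation of a PUBLISHED theorem with page reference. The manuscript(s) under audit are
NOT citable for their own disputed steps — they are the thing under adjudication; programme-internal (2001/route/tribunal) claims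
are never citable."  Nothing is cited here; every statement is a composition of the tree's own leaves.
-/

namespace Summit.QuantumFields.BalabanUV.Beta.CapRowsQhalfOneLoop

open Literature.MathematicalPhysics.QuantumFieldTheory.Balaban1983to89
open Literature.MathematicalPhysics.QuantumFieldTheory.Balaban1983to89.Beta
open FlowStep FlowStepRuns DagBinding
open B4ContourShift (latticeKernel)
open B4TorusKernel (descend gridPt)
open Metric
open Beta.RemainderChain (RemainderConst)
open Beta.RateCertificate (GeomRate)
open Beta.AveragedAFCarrier (BetaAvgAFH)
open Beta.AliasingTailL1 (StripRegularC aliasRatioL1)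
open Beta.AliasingTailLattice (codeTheta code16SetE)
open Summit.QuantumFields.BalabanUV.Beta.CapRows
open Summit.QuantumFields.BalabanUV.Beta.CapRowsQhalf (rowsOfCode16E_ofRealBall rowsOfCode16E_ofRealBall_consts)
open Summit.QuantumFields.BalabanUV.Beta.PolyRegularAlgebra (PolyHol MatPolyHol)
open Summit.QuantumFields.BalabanUV.Beta.PolyRegularRestrict (stripRegularC_oneLoopForm₂ stripRegularC_jet_of_bound₂)
open Summit.QuantumFields.BalabanUV.Beta.JetCoefficientCauchy (jetFunctional)
open Summit.QuantumFields.BalabanUV.Beta.ConjReflectionAlgebra (MatConjSymm ConjSymm₃ oneLoopForm_hsym jet_hsym)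

noncomputable section

/-! ## §1 The one-loop form, two widths, paired ball -/

section OneLoopForm

variable {b : ℕ → ℝ} {n : Type*} [Fintype n] [DecidableEq n]
variable {A A' B C D : (Fin 4 → ℂ) → Matrix n n ℂ} {a κ M : ℝ}

/-- **THE PAIRED-BALL ANCHOR ON THE ONE-LOOP FORM** (code16, engine convention; two widths): STRUCTURE `hA…hBt : MatPolyHol _ (fun _ => a)`,
REALITY `rA…rBt : MatConjSymm _` (⇒ `hsym` by `ConjReflectionAlgebra.oneLoopForm_hsym`), (Z1) `hdet hdet'` on `Strip 4 a`, (Z2) `hM` on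
`Strip 4 κ` (`0 < κ ≤ a`), (T) a certified REAL ball `hT` for `|S_E|⁻¹ Σ_{S_E} Re G`, (A) `hA₀`, cmp `hlo` ⟹ `Rows b`, `k₀ = 0`. [folklore] -/
def rowsOfOneLoopFormCode16E_ofRealBall₂
    (hb : b 0 = (latticeKernel (fun p => ((A p)⁻¹ * B p).trace - ((A p)⁻¹ * C p * (A' p)⁻¹ * D p).trace) 0).re)
    (hκ : 0 < κ) (hκa : κ ≤ a) (hA : MatPolyHol A (fun _ => a)) (hA' : MatPolyHol A' (fun _ => a))
    (hBst : MatPolyHol B (fun _ => a)) (hBs : MatPolyHol C (fun _ => a)) (hBt : MatPolyHol D (fun _ => a))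
    (rA : MatConjSymm A) (rA' : MatConjSymm A') (rBst : MatConjSymm B) (rBs : MatConjSymm C) (rBt : MatConjSymm D)
    (hdet : ∀ p ∈ B4Strip.Strip (3 + 1) a, (A p).det ≠ 0) (hdet' : ∀ p ∈ B4Strip.Strip (3 + 1) a, (A' p).det ≠ 0)
    (hM : ∀ p ∈ B4Strip.Strip (3 + 1) κ, ‖((A p)⁻¹ * B p).trace - ((A p)⁻¹ * C p * (A' p)⁻¹ * D p).trace‖ ≤ M)
    {N : ℕ} (hN : 1 ≤ N) [NeZero (4 * N)] {t r : ℝ}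
    (hT : |((code16SetE N).card : ℝ)⁻¹ *
        (∑ w ∈ code16SetE N, (descend (fun p => ((A p)⁻¹ * B p).trace - ((A p)⁻¹ * C p * (A' p)⁻¹ * D p).trace)
          (gridPt (4 * N) w)).re) - t| ≤ r)
    {A₀ : ℝ} (hA₀ : M * codeTheta (aliasRatioL1 κ N) ≤ A₀) (lo : ℚ) (hlo : ((lo : ℚ) : ℝ) ≤ t - r - A₀) : Rows b :=
  rowsOfCode16E_ofRealBall hb (stripRegularC_oneLoopForm₂ hκ.le hκa hA hA' hBst hBs hBt hdet hdet' hM) hκ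
    (oneLoopForm_hsym rA rA' rBst rBs rBt) hN hT hA₀ lo hlo

variable {β : HBeta}

/-- **THE CERTIFIED ROAD FROM THE PAIRED-BALL ONE-LOOP-FORM ANCHOR** — the QHALF campaign's typed target in ONE signature: the binders of
`rowsOfOneLoopFormCode16E_ofRealBall₂` (`b := S.β0`) + `GeomRate S.β0 binf c₀ θ` (`0 ≤ θ ≤ 1`) + `hk₂` at `k₀ = 0` + `RemainderConst S γ₀ r′` ⟹
`BetaAvgAFH (min lo (3(lo − c₀)/4) − r′) 0 γ₀ β`.  0 of these binders is instantiated in the tree. [folklore] -/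
theorem betaAvgAFH_of_oneLoopFormCode16E_ofRealBall₂ (S : B12Beta.OneLoopSplit β)
    (hb : S.β0 0 = (latticeKernel (fun p => ((A p)⁻¹ * B p).trace - ((A p)⁻¹ * C p * (A' p)⁻¹ * D p).trace) 0).re)
    (hκ : 0 < κ) (hκa : κ ≤ a) (hA : MatPolyHol A (fun _ => a)) (hA' : MatPolyHol A' (fun _ => a))
    (hBst : MatPolyHol B (fun _ => a)) (hBs : MatPolyHol C (fun _ => a)) (hBt : MatPolyHol D (fun _ => a))
    (rA : MatConjSymm A) (rA' : MatConjSymm A') (rBst : MatConjSymm B) (rBs : MatConjSymm C) (rBt : MatConjSymm D)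
    (hdet : ∀ p ∈ B4Strip.Strip (3 + 1) a, (A p).det ≠ 0) (hdet' : ∀ p ∈ B4Strip.Strip (3 + 1) a, (A' p).det ≠ 0)
    (hM : ∀ p ∈ B4Strip.Strip (3 + 1) κ, ‖((A p)⁻¹ * B p).trace - ((A p)⁻¹ * C p * (A' p)⁻¹ * D p).trace‖ ≤ M)
    {N : ℕ} (hN : 1 ≤ N) [NeZero (4 * N)] {t rT : ℝ}
    (hT : |((code16SetE N).card : ℝ)⁻¹ *
        (∑ w ∈ code16SetE N, (descend (fun p => ((A p)⁻¹ * B p).trace - ((A p)⁻¹ * C p * (A' p)⁻¹ * D p).trace)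
          (gridPt (4 * N) w)).re) - t| ≤ rT)
    {A₀ : ℝ} (hA₀ : M * codeTheta (aliasRatioL1 κ N) ≤ A₀) (lo : ℚ) (hlo : ((lo : ℚ) : ℝ) ≤ t - rT - A₀)
    {γ₀ binf c₀ θ r : ℝ} (hθ0 : 0 ≤ θ) (hθ1 : θ ≤ 1) (hconv : GeomRate S.β0 binf c₀ θ)
    (hk₂ : c₀ * θ ^ (0 + 1) ≤ ((lo : ℝ) - c₀ * θ ^ 0) / 4) (hrem : RemainderConst S γ₀ r) :
    BetaAvgAFH (min ((lo : ℚ) : ℝ) (3 * ((lo : ℝ) - c₀ * θ ^ 0) / 4) - r) 0 γ₀ β := by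
  have key := betaAvgAFH_of_capRows S
    (rowsOfOneLoopFormCode16E_ofRealBall₂ hb hκ hκa hA hA' hBst hBs hBt rA rA' rBst rBs rBt hdet hdet' hM hN hT hA₀ lo hlo)
    hθ0 hθ1 hconv hk₂ hrem
  rwa [rowsOfOneLoopFormCode16E_ofRealBall₂,
    (rowsOfCode16E_ofRealBall_consts hb (stripRegularC_oneLoopForm₂ hκ.le hκa hA hA' hBst hBs hBt hdet hdet' hM) hκ
      (oneLoopForm_hsym rA rA' rBst rBs rBt) hN hT hA₀ lo hlo).2.2] at key

end OneLoopForm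

/-! ## §2 The jet functional, two widths, paired ball -/

section Jet

variable {b : ℕ → ℝ} {a κ : ℝ} {f : (Fin 4 → ℂ) → ℂ → ℂ → ℂ} {r C : ℝ}

/-- **THE PAIRED-BALL ANCHOR ON THE JET FUNCTIONAL** (`G = jetFunctional f`; two widths): STRUCTURE `hG : PolyHol (jetFunctional f) (fun _ => a)`,
REALITY `rf : ConjSymm₃ f` (joint reflection `(q; p₁, p₂) ↦ (−q̄; −p̄₁, −p̄₂)` ⇒ `hsym` by `jet_hsym`), the mixed-Cauchy data at `κ ≤ a` with the (Z2)
certificate `hC`, (T) a certified REAL ball, (A) with `M := C/(2r²)`, cmp ⟹ `Rows b`, `k₀ = 0`. [folklore] -/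
def rowsOfJetCode16E_ofRealBall₂
    (hb : b 0 = (latticeKernel (jetFunctional f) 0).re) (hκ : 0 < κ) (hκa : κ ≤ a) (hr : 0 < r)
    (hG : PolyHol (jetFunctional f) (fun _ => a)) (rf : ConjSymm₃ f)
    (h₂ : ∀ q ∈ B4Strip.Strip (3 + 1) κ, ∀ p₁ ∈ closedBall (0 : ℂ) r, DiffContOnCl ℂ (f q p₁) (ball 0 r))
    (hC : ∀ q ∈ B4Strip.Strip (3 + 1) κ, ∀ p₁ ∈ closedBall (0 : ℂ) r, ∀ p₂ ∈ sphere (0 : ℂ) r, ‖f q p₁ p₂‖ ≤ C)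
    (h₁ : ∀ q ∈ B4Strip.Strip (3 + 1) κ, DiffContOnCl ℂ (fun p₁ => deriv (f q p₁) 0) (ball 0 r))
    {N : ℕ} (hN : 1 ≤ N) [NeZero (4 * N)] {t rT : ℝ}
    (hT : |((code16SetE N).card : ℝ)⁻¹ * (∑ w ∈ code16SetE N, (descend (jetFunctional f) (gridPt (4 * N) w)).re) - t| ≤ rT)
    {A₀ : ℝ} (hA₀ : C / (2 * r ^ 2) * codeTheta (aliasRatioL1 κ N) ≤ A₀) (lo : ℚ) (hlo : ((lo : ℚ) : ℝ) ≤ t - rT - A₀) :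
    Rows b :=
  rowsOfCode16E_ofRealBall hb (stripRegularC_jet_of_bound₂ hr hκa hG h₂ hC h₁) hκ (jet_hsym rf) hN hT hA₀ lo hlo

variable {β : HBeta}

/-- **THE CERTIFIED ROAD FROM THE PAIRED-BALL JET ANCHOR** — one signature. [folklore] -/
theorem betaAvgAFH_of_jetCode16E_ofRealBall₂ (S : B12Beta.OneLoopSplit β)
    (hb : S.β0 0 = (latticeKernel (jetFunctional f) 0).re) (hκ : 0 < κ) (hκa : κ ≤ a) (hr : 0 < r)
    (hG : PolyHol (jetFunctional f) (fun _ => a)) (rf : ConjSymm₃ f)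
    (h₂ : ∀ q ∈ B4Strip.Strip (3 + 1) κ, ∀ p₁ ∈ closedBall (0 : ℂ) r, DiffContOnCl ℂ (f q p₁) (ball 0 r))
    (hC : ∀ q ∈ B4Strip.Strip (3 + 1) κ, ∀ p₁ ∈ closedBall (0 : ℂ) r, ∀ p₂ ∈ sphere (0 : ℂ) r, ‖f q p₁ p₂‖ ≤ C)
    (h₁ : ∀ q ∈ B4Strip.Strip (3 + 1) κ, DiffContOnCl ℂ (fun p₁ => deriv (f q p₁) 0) (ball 0 r))
    {N : ℕ} (hN : 1 ≤ N) [NeZero (4 * N)] {t rT : ℝ}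
    (hT : |((code16SetE N).card : ℝ)⁻¹ * (∑ w ∈ code16SetE N, (descend (jetFunctional f) (gridPt (4 * N) w)).re) - t| ≤ rT)
    {A₀ : ℝ} (hA₀ : C / (2 * r ^ 2) * codeTheta (aliasRatioL1 κ N) ≤ A₀) (lo : ℚ) (hlo : ((lo : ℚ) : ℝ) ≤ t - rT - A₀)
    {γ₀ binf c₀ θ r' : ℝ} (hθ0 : 0 ≤ θ) (hθ1 : θ ≤ 1) (hconv : GeomRate S.β0 binf c₀ θ)
    (hk₂ : c₀ * θ ^ (0 + 1) ≤ ((lo : ℝ) - c₀ * θ ^ 0) / 4) (hrem : RemainderConst S γ₀ r') :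
    BetaAvgAFH (min ((lo : ℚ) : ℝ) (3 * ((lo : ℝ) - c₀ * θ ^ 0) / 4) - r') 0 γ₀ β := by
  have key := betaAvgAFH_of_capRows S
    (rowsOfJetCode16E_ofRealBall₂ hb hκ hκa hr hG rf h₂ hC h₁ hN hT hA₀ lo hlo) hθ0 hθ1 hconv hk₂ hrem
  rwa [rowsOfJetCode16E_ofRealBall₂,
    (rowsOfCode16E_ofRealBall_consts hb (stripRegularC_jet_of_bound₂ hr hκa hG h₂ hC h₁) hκ (jet_hsym rf) hN hT hA₀
      lo hlo).2.2] at key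

end Jet

end

end Summit.QuantumFields.BalabanUV.Beta.CapRowsQhalfOneLoop
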